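import Literature.NumberTheory.BeurlingPrimes.BDRZeta
import HarnessLib

/-!
# BDR 2023, Theorem 3.2: the continued zeta function `E(s)e^{Z(s)}`, its real simple poles and residues

Topic `Literature/NumberTheory/BeurlingPrimes`, grouping namespace `BDR`. Everything in this file is PROVED.

Broucke–Debruyne–Révész (2023), proof of Theorem 3.2, second assertion: "To establish the asymptotic behavior
of `N_𝒫(x)`, we perform a Perron inversion in the spirit of [Diamond–Zhang] … We transfer the integration contour
… which is justified in view of the bound (3.4). By the residue theorem we get
`∫_x^{x+1} N_𝒫 = a(x+1/2) + [Σ_{ω∈S, Re ω>σ₀} u^{ω+1} Σ_j b̃_{ω,j}(log u)^j]_x^{x+1} + (1/2πi)∫_Γ …`, where `a > 0`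
is the residue of `ζ_𝒫(s)` at `s = 1`, and … `b̃_{ω,m(ω)−1} ≠ 0`."

For the tree's vendored form (real simple zeros `R` and poles `S`), the continued zeta function
`G(s) = E(s)e^{Z(s)}` (`contZeta`, with `E`, `Z` from `BDRZeta.lean`) has, in the half-plane `Re s > 1/2`, simple
poles exactly at `T = {1} ∪ {ω ∈ S : ω > 1/2}` (`poles S`). This file supplies the algebra and the analysis of these
poles in the shape consumed by the tree's contour-shift engine `perron_integral_eq_residues_add`
(`PerronShift.lean`):

* `dslopes`, `eq_prod_mul_dslopes`, `differentiableOn_dslopes` — the **factor theorem** for holomorphic functions at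
  finitely many simple zeros, by iterating Mathlib's `dslope`;
* `Nfun` (the regular numerator, `G = Nfun/∏_{p∈T}(s−p)` on `Re s > 1/2`, `contZeta_eq_Nfun_div`), the residues
  `res p = Nfun(p)/∏_{q≠p}(p−q)`, the regular part `H` (`contZeta_eq_polePart_add_H`: `G = Σ_p res_p/(s−p) + H`
  with `H` holomorphic on `Re s > 1/2`, `differentiableOn_H`);
* the residues are real (`res_eq_ofReal`), `a = res 1 > 0` (`resR_one_pos`) and `res ω ≠ 0` for `ω ∈ S`, `ω > 1/2`
  when `R ∩ S = ∅` (`resR_ne_zero`);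
* `norm_E_le` — `‖E(s)‖ ≤ 5 (2/η)^{|S|} 3^{|R|} (1 + δ/(1/2−δ))^M` when `‖s−1‖ ≥ 1/4`, `‖s−ω‖ ≥ η` (`ω ∈ S`),
  `Re s > 1/2 > δ`, and the resulting majorant of `G` on the strip `1/2 + η ≤ Re s ≤ 3/2` (`norm_contZeta_le`).

## References
* [BrouckeDebruyneRevesz2023] F. Broucke, G. Debruyne, Sz. Gy. Révész, *Some examples of well-behaved Beurling
  number systems*, arXiv:2309.01567, proof of Theorem 3.2 ((3.5)–(3.8) and the residues at `s = 1`, `s = ω`) (read,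
  pp. 8–9).
-/

noncomputable section

open Complex Set Filter MeasureTheory Real
open scoped Topology

namespace Literature.NumberTheory.BeurlingPrimes

open Literature.Barriers.RiemannHypothesis

namespace BDR

/-! ### The factor theorem at finitely many simple zeros -/

/-- Iterated divided differences: `dslopes [a₁,…,aₙ] ψ = dslope (… (dslope ψ a₁) …) aₙ`. [folklore] -/
def dslopes : List ℂ → (ℂ → ℂ) → ℂ → ℂ
  | [], ψ => ψ
  | a :: l, ψ => dslopes l (dslope ψ a)

/-- **Factor theorem**: if `ψ` vanishes at the distinct points of `l` then
`ψ(s) = ∏_{a∈l} (s − a) · dslopes l ψ s` for all `s`. [folklore] -/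
theorem eq_prod_mul_dslopes : ∀ (l : List ℂ), l.Nodup → ∀ {ψ : ℂ → ℂ}, (∀ a ∈ l, ψ a = 0) →
    ∀ s : ℂ, ψ s = (l.map fun a ↦ s - a).prod * dslopes l ψ s
  | [], _, ψ, _, s => by simp [dslopes]
  | a :: l, hl, ψ, hψ, s => by
    have hnd : l.Nodup := (List.nodup_cons.mp hl).2
    have hal : a ∉ l := (List.nodup_cons.mp hl).1
    have hzero : ∀ b ∈ l, dslope ψ a b = 0 := by
      intro b hb
      have hba : b ≠ a := fun h ↦ hal (h ▸ hb)
      have h1 := sub_smul_dslope ψ a b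
      rw [hψ b (List.mem_cons_of_mem a hb), hψ a List.mem_cons_self, sub_self, smul_eq_mul] at h1
      exact (mul_eq_zero.mp h1).resolve_left (sub_ne_zero.mpr hba)
    have ih := eq_prod_mul_dslopes l hnd hzero s
    have h0 := sub_smul_dslope ψ a s
    rw [hψ a List.mem_cons_self, sub_zero, smul_eq_mul] at h0
    rw [dslopes, List.map_cons, List.prod_cons, ← h0, ih]
    ring

/-- The iterated divided differences of a holomorphic function are holomorphic (on an open set containing the
points). [folklore] -/
theorem differentiableOn_dslopes {U : Set ℂ} (hU : IsOpen U) :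
    ∀ (l : List ℂ), (∀ a ∈ l, a ∈ U) → ∀ {ψ : ℂ → ℂ}, DifferentiableOn ℂ ψ U → DifferentiableOn ℂ (dslopes l ψ) U
  | [], _, ψ, hψ => by simpa [dslopes] using hψ
  | a :: l, hl, ψ, hψ => by
    rw [dslopes]
    refine differentiableOn_dslopes hU l (fun b hb ↦ hl b (List.mem_cons_of_mem a hb)) ?_
    exact (Complex.differentiableOn_dslope (hU.mem_nhds (hl a List.mem_cons_self))).mpr hψ

/-! ### The poles, the regular numerator and the residues -/

variable (R S : Finset ℝ) (δ : ℝ) (M : ℕ) (P : BeurlingPrimes)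

/-- **The poles of `E(s)e^{Z(s)}` in `Re s > 1/2`**: `T = {1} ∪ {ω ∈ S : ω > 1/2}`.
[cite: BrouckeDebruyneRevesz2023, proof of Theorem 3.2 (3.7)] -/
def poles (S : Finset ℝ) : Finset ℝ := insert 1 (S.filter fun ω ↦ 1 / 2 < ω)

/-- **The continued zeta function `G(s) = E(s) e^{Z(s)}`** (`= ζ_P(s)` for `Re s > 1`).
[cite: BrouckeDebruyneRevesz2023, Theorem 3.2 ("`ζ_𝒫(s) = E(s)e^{Z(s)}`")] -/
def contZeta (s : ℂ) : ℂ := E R S δ M s * Complex.exp (Z R S δ M P s)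

/-- The regular numerator `Nfun(s) = s ∏_{ω∈S} s ∏_{ω∈S, ω≤1/2} (s−ω)⁻¹ ∏_{ρ∈R} (s−ρ)/s (s/(s−δ))^M e^{Z(s)}`, holomorphic
and pole-free on `Re s > 1/2`, with `G = Nfun/∏_{p ∈ T}(s − p)`. [cite: BrouckeDebruyneRevesz2023, proof of Theorem 3.2] -/
def Nfun (s : ℂ) : ℂ :=
  s * (∏ _ω ∈ S, s) * (∏ ω ∈ S with ω ≤ 1 / 2, (s - ω)⁻¹) * (∏ ρ ∈ R, (s - ρ) / s) * (s / (s - δ)) ^ M *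
    Complex.exp (Z R S δ M P s)

/-- The real form of `Nfun` on the real axis (`Z(σ) ∈ ℝ`). [cite: BrouckeDebruyneRevesz2023, proof of Theorem 3.2] -/
def NfunR (p : ℝ) : ℝ :=
  p * p ^ S.card * (∏ ω ∈ S with ω ≤ 1 / 2, (p - ω)⁻¹) * (∏ ρ ∈ R, (p - ρ) / p) * (p / (p - δ)) ^ M *
    Real.exp (p * ∫ x in Ioi (1 : ℝ), (P.riemannPrimeCount x - G R S δ M x) * x ^ (-p - 1))

/-- **The residue of `G` at `p ∈ T`**: `res p = Nfun(p)/∏_{q ∈ T, q ≠ p}(p − q)` (`res 1 = a`, `res ω = ω b_ω`).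
[cite: BrouckeDebruyneRevesz2023, proof of Theorem 3.2 (3.7)] -/
def res (p : ℝ) : ℂ := Nfun R S δ M P p / ∏ q ∈ (poles S).erase p, ((p : ℂ) - q)

/-- The residues as real numbers. [cite: BrouckeDebruyneRevesz2023, proof of Theorem 3.2] -/
def resR (p : ℝ) : ℝ := NfunR R S δ M P p / ∏ q ∈ (poles S).erase p, (p - q)

variable {R S δ M P}

/-- Membership in `T`. [folklore] -/
theorem mem_poles {p : ℝ} : p ∈ poles S ↔ p = 1 ∨ (p ∈ S ∧ 1 / 2 < p) := by
  simp [poles, Finset.mem_filter]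

/-- `∏_{ω∈S} (s − ω) = ∏_{ω > 1/2} (s − ω) · ∏_{ω ≤ 1/2} (s − ω)`. [folklore] -/
theorem prod_sub_split (s : ℂ) :
    ∏ ω ∈ S, (s - ω) = (∏ ω ∈ S with 1 / 2 < ω, (s - ω)) * ∏ ω ∈ S with ω ≤ 1 / 2, (s - ω) := by
  rw [← Finset.prod_filter_mul_prod_filter_not S (fun ω ↦ 1 / 2 < ω)]
  congr 1
  refine Finset.prod_congr ?_ fun _ _ ↦ rfl
  ext ω; simp [not_lt]

/-- `∏_{p∈T} (s − p) = (s − 1) ∏_{ω∈S, ω>1/2} (s − ω)` when `1 ∉ S`. [folklore] -/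
theorem prod_poles_eq (hS : ∀ ω ∈ S, ω < 1) (s : ℂ) :
    ∏ p ∈ poles S, (s - p) = (s - 1) * ∏ ω ∈ S with 1 / 2 < ω, (s - ω) := by
  rw [poles, Finset.prod_insert]
  · push_cast; ring
  · intro h1
    rw [Finset.mem_filter] at h1
    exact absurd (hS 1 h1.1) (lt_irrefl 1)

/-- **`G = Nfun / ∏_{p∈T}(s − p)`** on `Re s > 1/2` off `T`. [cite: BrouckeDebruyneRevesz2023, proof of Theorem 3.2] -/
theorem contZeta_eq_Nfun_div (h : Adm R S δ M) {s : ℂ} (hs : 1 / 2 < s.re) (hsT : ∀ p ∈ poles S, s ≠ (p : ℂ)) :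
    contZeta R S δ M P s = Nfun R S δ M P s / ∏ p ∈ poles S, (s - p) := by
  have hS1 : ∀ ω ∈ S, ω < 1 := fun ω hω ↦ (h.hS ω hω).2
  have hs0 : s ≠ 0 := fun h0 ↦ by rw [h0] at hs; simp at hs; linarith
  have hs1 : s - 1 ≠ 0 := sub_ne_zero.mpr (hsT 1 (mem_poles.mpr (Or.inl rfl)) )
  have hsub : ∀ ω ∈ S, s - (ω : ℂ) ≠ 0 := by
    intro ω hω h0
    rcases lt_or_ge (1 / 2 : ℝ) ω with hω2 | hω2
    · exact hsT ω (mem_poles.mpr (Or.inr ⟨hω, hω2⟩)) (sub_eq_zero.mp h0)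
    · have := congrArg Complex.re h0; simp at this; linarith
  have hprod1 : ∏ ω ∈ S with 1 / 2 < ω, (s - ω) ≠ 0 :=
    Finset.prod_ne_zero_iff.mpr fun ω hω ↦ hsub ω (Finset.mem_filter.mp hω).1
  have hprod2 : ∏ ω ∈ S with ω ≤ 1 / 2, (s - ω) ≠ 0 :=
    Finset.prod_ne_zero_iff.mpr fun ω hω ↦ hsub ω (Finset.mem_filter.mp hω).1
  rw [contZeta, E, Nfun, prod_poles_eq hS1, eq_div_iff (mul_ne_zero hs1 hprod1)]
  have hE1 : ∏ ω ∈ S, s / (s - ω) = (∏ _ω ∈ S, s) * (∏ ω ∈ S, (s - ω))⁻¹ := by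
    rw [← Finset.prod_inv_distrib, ← Finset.prod_mul_distrib]
    exact Finset.prod_congr rfl fun ω _ ↦ div_eq_mul_inv _ _
  rw [hE1, prod_sub_split, mul_inv, Finset.prod_inv_distrib]
  have e1 : s / (s - 1) * (s - 1) = s := div_mul_cancel₀ s hs1
  have e2 : (∏ ω ∈ S with 1 / 2 < ω, (s - ω))⁻¹ * ∏ ω ∈ S with 1 / 2 < ω, (s - ω) = 1 := inv_mul_cancel₀ hprod1
  calc _ = (s / (s - 1) * (s - 1)) * (∏ _ω ∈ S, s) *
        ((∏ ω ∈ S with 1 / 2 < ω, (s - ω))⁻¹ * ∏ ω ∈ S with 1 / 2 < ω, (s - ω)) *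
        (∏ ω ∈ S with ω ≤ 1 / 2, (s - ω))⁻¹ * (∏ ρ ∈ R, (s - ρ) / s) * (s / (s - δ)) ^ M *
        Complex.exp (Z R S δ M P s) := by ring
    _ = _ := by rw [e1, e2]; ring

/-- **`Nfun` on the real axis is real**: `Nfun p = NfunR p`. [cite: BrouckeDebruyneRevesz2023, proof of Theorem 3.2] -/
theorem Nfun_ofReal (p : ℝ) : Nfun R S δ M P p = ((NfunR R S δ M P p : ℝ) : ℂ) := by
  rw [Nfun, NfunR, Z_ofReal, Finset.prod_const]
  push_cast
  ring

/-- **The residues are real**: `res p = resR p`. [cite: BrouckeDebruyneRevesz2023, proof of Theorem 3.2] -/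
theorem res_eq_ofReal (p : ℝ) : res R S δ M P p = ((resR R S δ M P p : ℝ) : ℂ) := by
  rw [res, resR, Nfun_ofReal]
  push_cast
  rfl

/-- **`a = res 1 > 0`** (`R, S ⊂ (0,1)`, `0 < δ < 1`, `Z(1) ∈ ℝ`). [cite: BrouckeDebruyneRevesz2023, Theorem 3.2 ("`a > 0`")] -/
theorem resR_one_pos (h : Adm R S δ M) : 0 < resR R S δ M P 1 := by
  unfold resR NfunR
  refine div_pos ?_ (Finset.prod_pos fun q hq ↦ ?_)
  · refine mul_pos (mul_pos (mul_pos (mul_pos (mul_pos one_pos (by simp)) ?_) ?_) ?_) (Real.exp_pos _)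
    · exact Finset.prod_pos fun ω hω ↦ inv_pos.mpr (by linarith [(h.hS ω (Finset.mem_filter.mp hω).1).2])
    · exact Finset.prod_pos fun ρ hρ ↦ by rw [div_one]; linarith [(h.hR ρ hρ).2]
    · exact pow_pos (div_pos one_pos (by linarith [h.hδ1])) M
  · obtain ⟨hq1, hq⟩ := Finset.mem_erase.mp hq
    rcases mem_poles.mp hq with h1 | ⟨hqS, -⟩
    · exact absurd h1 hq1
    · linarith [(h.hS q hqS).2]

/-- **`res ω ≠ 0` for `ω ∈ S`, `ω > 1/2`** when `R ∩ S = ∅` and `δ < 1/2` (so `b_ω = res ω/ω ≠ 0`).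
[cite: BrouckeDebruyneRevesz2023, Theorem 3.2 ("`b_{ω,m(ω)−1} ≠ 0`")] -/
theorem resR_ne_zero (hRS : Disjoint R S) (hδ2 : δ < 1 / 2) {ω : ℝ} (hω : ω ∈ S)
    (hω2 : 1 / 2 < ω) : resR R S δ M P ω ≠ 0 := by
  have hω0 : ω ≠ 0 := by linarith
  unfold resR NfunR
  refine div_ne_zero ?_ (Finset.prod_ne_zero_iff.mpr fun q hq ↦ ?_)
  · refine mul_ne_zero (mul_ne_zero (mul_ne_zero (mul_ne_zero (mul_ne_zero hω0 (pow_ne_zero _ hω0)) ?_) ?_) ?_)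
      (Real.exp_pos _).ne'
    · exact Finset.prod_ne_zero_iff.mpr fun ω' hω' ↦
        inv_ne_zero (by linarith [(Finset.mem_filter.mp hω').2] : ω - ω' ≠ 0)
    · refine Finset.prod_ne_zero_iff.mpr fun ρ hρ ↦ div_ne_zero (sub_ne_zero.mpr ?_) hω0
      exact fun heq ↦ Finset.disjoint_left.mp hRS hρ (heq ▸ hω)
    · exact pow_ne_zero _ (div_ne_zero hω0 (by linarith : ω - δ ≠ 0))
  · obtain ⟨hq1, hq⟩ := Finset.mem_erase.mp hq
    exact sub_ne_zero.mpr (Ne.symm hq1)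

/-! ### The regular part `H` -/

variable (R S δ M P)

/-- `Φ(s) = Nfun(s) − Σ_{p∈T} res_p ∏_{q≠p} (s − q)`, holomorphic on `Re s > 1/2` and vanishing on `T`.
[cite: BrouckeDebruyneRevesz2023, proof of Theorem 3.2] -/
def Phi (s : ℂ) : ℂ :=
  Nfun R S δ M P s - ∑ p ∈ poles S, res R S δ M P p * ∏ q ∈ (poles S).erase p, (s - q)

/-- **The regular part `H`** of `G` at its poles in `Re s > 1/2`: the iterated divided difference of `Φ` at the
points of `T` (so that `Φ = ∏_{p∈T}(s−p) · H`). [cite: BrouckeDebruyneRevesz2023, proof of Theorem 3.2 (3.8)] -/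
def H : ℂ → ℂ := dslopes ((poles S).toList.map fun p : ℝ ↦ (p : ℂ)) (Phi R S δ M P)

variable {R S δ M P}

/-- `Φ` vanishes on `T`. [folklore] -/
theorem Phi_apply_pole {p : ℝ} (hp : p ∈ poles S) : Phi R S δ M P p = 0 := by
  rw [Phi, ← Finset.add_sum_erase _ _ hp]
  have hzero : ∑ p' ∈ (poles S).erase p, res R S δ M P p' * ∏ q ∈ (poles S).erase p', ((p : ℂ) - q) = 0 := by
    refine Finset.sum_eq_zero fun p' hp' ↦ ?_
    obtain ⟨hne, hp'T⟩ := Finset.mem_erase.mp hp'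
    have hmem : p ∈ (poles S).erase p' := Finset.mem_erase.mpr ⟨Ne.symm hne, hp⟩
    rw [Finset.prod_eq_zero (f := fun q : ℝ ↦ ((p : ℂ) - q)) hmem (sub_self _), mul_zero]
  rw [hzero, add_zero, res, div_mul_cancel₀, sub_self]
  exact Finset.prod_ne_zero_iff.mpr fun q hq ↦ sub_ne_zero.mpr (by
    have := (Finset.mem_erase.mp hq).1
    exact_mod_cast Ne.symm this)

/-- **`Φ = ∏_{p∈T}(s−p) · H`** everywhere. [folklore] -/
theorem Phi_eq_prod_mul_H (s : ℂ) : Phi R S δ M P s = (∏ p ∈ poles S, (s - p)) * H R S δ M P s := by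
  have hnd : ((poles S).toList.map fun p : ℝ ↦ (p : ℂ)).Nodup :=
    (Finset.nodup_toList _).map Complex.ofReal_injective
  have hzero : ∀ a ∈ ((poles S).toList.map fun p : ℝ ↦ (p : ℂ)), Phi R S δ M P a = 0 := by
    intro a ha
    obtain ⟨p, hp, rfl⟩ := List.mem_map.mp ha
    exact Phi_apply_pole (Finset.mem_toList.mp hp)
  have h1 := eq_prod_mul_dslopes _ hnd hzero s
  rw [List.map_map] at h1
  have h2 : (((poles S).toList).map ((fun a ↦ s - a) ∘ fun p : ℝ ↦ (p : ℂ))).prod = ∏ p ∈ poles S, (s - (p : ℂ)) :=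
    Finset.prod_map_toList _ _
  rw [h2] at h1
  exact h1

/-- **`G = Σ_{p∈T} res_p/(s − p) + H`** on `Re s > 1/2` off `T`. [cite: BrouckeDebruyneRevesz2023, proof of Theorem 3.2 (3.7)–(3.8)] -/
theorem contZeta_eq_polePart_add_H (h : Adm R S δ M) {s : ℂ} (hs : 1 / 2 < s.re)
    (hsT : ∀ p ∈ poles S, s ≠ (p : ℂ)) :
    contZeta R S δ M P s = polePart (poles S) (res R S δ M P) s + H R S δ M P s := by
  have hne : ∀ p ∈ poles S, s - (p : ℂ) ≠ 0 := fun p hp ↦ sub_ne_zero.mpr (hsT p hp)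
  have hprod : ∏ p ∈ poles S, (s - p) ≠ 0 := Finset.prod_ne_zero_iff.mpr hne
  have hH : H R S δ M P s = Phi R S δ M P s / ∏ p ∈ poles S, (s - p) := by
    rw [Phi_eq_prod_mul_H, mul_div_cancel_left₀ _ hprod]
  rw [contZeta_eq_Nfun_div h hs hsT, hH, Phi, sub_div, Finset.sum_div, polePart]
  have hterm : ∀ p ∈ poles S, res R S δ M P p * (∏ q ∈ (poles S).erase p, (s - q)) / ∏ q ∈ poles S, (s - q) =
      res R S δ M P p / (s - p) := by
    intro p hp
    rw [← Finset.mul_prod_erase _ _ hp, mul_div_mul_right _ _ (Finset.prod_ne_zero_iff.mpr fun q hq ↦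
      hne q (Finset.mem_erase.mp hq).2)]
  rw [Finset.sum_congr rfl hterm]
  ring

/-- `Nfun` is holomorphic on `Re s > 1/2`. [cite: BrouckeDebruyneRevesz2023, proof of Theorem 3.2] -/
theorem differentiableOn_Nfun (h : Adm R S δ M) (hδ2 : δ < 1 / 2) {A' : ℝ}
    (hπ : ∀ y : ℝ, 1 ≤ y → |(P.primeCount y : ℝ) - F R S δ M y| ≤ A') :
    DifferentiableOn ℂ (Nfun R S δ M P) {s : ℂ | 1 / 2 < s.re} := by
  have hZ : DifferentiableOn ℂ (Z R S δ M P) {s : ℂ | 1 / 2 < s.re} :=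
    (h.differentiableOn_Z P hπ).mono fun s hs ↦ by simp only [mem_setOf_eq] at hs ⊢; linarith
  have hne0 : ∀ s ∈ {s : ℂ | 1 / 2 < s.re}, s ≠ 0 := fun s hs h0 ↦ by
    simp only [mem_setOf_eq] at hs; rw [h0] at hs; simp at hs; linarith
  have hneω : ∀ ω ∈ S.filter (fun ω ↦ ω ≤ 1 / 2), ∀ s ∈ {s : ℂ | 1 / 2 < s.re}, s - (ω : ℂ) ≠ 0 := by
    intro ω hω s hs h0
    have := congrArg Complex.re h0
    simp only [mem_setOf_eq] at hs; simp at this; linarith [(Finset.mem_filter.mp hω).2]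
  have hneδ : ∀ s ∈ {s : ℂ | 1 / 2 < s.re}, s - (δ : ℂ) ≠ 0 := fun s hs h0 ↦ by
    have := congrArg Complex.re h0
    simp only [mem_setOf_eq] at hs; simp at this; linarith
  unfold Nfun
  refine ((((differentiableOn_id.mul (DifferentiableOn.fun_finsetProd fun _ _ ↦ differentiableOn_id)).mul
    (DifferentiableOn.fun_finsetProd fun ω hω ↦ ?_)).mul (DifferentiableOn.fun_finsetProd fun ρ _ ↦ ?_)).mul
    ((differentiableOn_id.div (differentiableOn_id.sub (differentiableOn_const _)) hneδ).pow M)).mul hZ.cexp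
  · exact (differentiableOn_id.sub (differentiableOn_const _)).inv (hneω ω hω)
  · exact (differentiableOn_id.sub (differentiableOn_const _)).div differentiableOn_id hne0

/-- `Φ` is holomorphic on `Re s > 1/2`. [folklore] -/
theorem differentiableOn_Phi (h : Adm R S δ M) (hδ2 : δ < 1 / 2) {A' : ℝ}
    (hπ : ∀ y : ℝ, 1 ≤ y → |(P.primeCount y : ℝ) - F R S δ M y| ≤ A') :
    DifferentiableOn ℂ (Phi R S δ M P) {s : ℂ | 1 / 2 < s.re} := by
  unfold Phi
  refine (differentiableOn_Nfun h hδ2 hπ).sub (DifferentiableOn.fun_sum fun p _ ↦ ?_)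
  exact (differentiableOn_const _).mul (DifferentiableOn.fun_finsetProd fun q _ ↦
    differentiableOn_id.sub (differentiableOn_const _))

/-- **`H` is holomorphic on `Re s > 1/2`.** [cite: BrouckeDebruyneRevesz2023, proof of Theorem 3.2 (3.8)] -/
theorem differentiableOn_H (h : Adm R S δ M) (hδ2 : δ < 1 / 2) {A' : ℝ}
    (hπ : ∀ y : ℝ, 1 ≤ y → |(P.primeCount y : ℝ) - F R S δ M y| ≤ A') :
    DifferentiableOn ℂ (H R S δ M P) {s : ℂ | 1 / 2 < s.re} := by
  refine differentiableOn_dslopes (isOpen_lt continuous_const Complex.continuous_re) _ (fun a ha ↦ ?_)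
    (differentiableOn_Phi h hδ2 hπ)
  obtain ⟨p, hp, rfl⟩ := List.mem_map.mp ha
  rcases mem_poles.mp (Finset.mem_toList.mp hp) with h1 | ⟨-, hp2⟩
  · rw [h1]; norm_num
  · simpa using hp2


/-! ### Bounds for `E` and `G = E e^Z` -/

/-- `‖s/(s − c)‖ ≤ 1 + c/d` when `‖s − c‖ ≥ d > 0`, `c ≥ 0` (`s/(s−c) = 1 + c/(s−c)`). [folklore] -/
theorem norm_div_sub_le {s : ℂ} {c d : ℝ} (hc : 0 ≤ c) (hd : 0 < d) (hsc : d ≤ ‖s - c‖) :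
    ‖s / (s - c)‖ ≤ 1 + c / d := by
  have hne : s - (c : ℂ) ≠ 0 := by
    intro h0; rw [h0, norm_zero] at hsc; linarith
  have heq : s / (s - c) = 1 + c / (s - c) := by field_simp; ring
  rw [heq]
  refine (norm_add_le _ _).trans ?_
  rw [norm_one, norm_div, Complex.norm_real, Real.norm_eq_abs, abs_of_nonneg hc]
  exact add_le_add le_rfl (div_le_div_of_nonneg_left hc hd hsc)

/-- `‖(s − c)/s‖ ≤ 3` for `Re s > 1/2`, `0 ≤ c ≤ 1`. [folklore] -/
theorem norm_sub_div_le {s : ℂ} {c : ℝ} (hc0 : 0 ≤ c) (hc1 : c ≤ 1) (hs : 1 / 2 < s.re) : ‖(s - c) / s‖ ≤ 3 := by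
  have hsn : 1 / 2 < ‖s‖ := lt_of_lt_of_le hs ((le_abs_self _).trans (Complex.abs_re_le_norm s))
  have hs0 : s ≠ 0 := fun h0 ↦ by rw [h0, norm_zero] at hsn; linarith
  have heq : (s - c) / s = 1 - c / s := by field_simp
  rw [heq]
  refine (norm_sub_le _ _).trans ?_
  rw [norm_one, norm_div, Complex.norm_real, Real.norm_eq_abs, abs_of_nonneg hc0]
  have : c / ‖s‖ ≤ 2 := by
    rw [div_le_iff₀ (by linarith)]; nlinarith
  linarith

variable (R S δ M)

/-- The majorant of `‖E‖`: `5 (2/η)^{|S|} 3^{|R|} (1 + δ/(1/2 − δ))^M`. [cite: BrouckeDebruyneRevesz2023, proof of Theorem 3.2] -/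
def Emaj (η : ℝ) : ℝ := 5 * (2 / η) ^ S.card * 3 ^ R.card * (1 + δ / (1 / 2 - δ)) ^ M

variable {R S δ M}

/-- `Emaj ≥ 5`. [folklore] -/
theorem five_le_Emaj (hδ0 : 0 ≤ δ) (hδ2 : δ < 1 / 2) {η : ℝ} (hη0 : 0 < η) (hη1 : η ≤ 1) : 5 ≤ Emaj R S δ M η := by
  unfold Emaj
  have h1 : 1 ≤ (2 / η) ^ S.card := one_le_pow₀ (by rw [le_div_iff₀ hη0]; linarith)
  have h2 : (1 : ℝ) ≤ 3 ^ R.card := one_le_pow₀ (by norm_num)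
  have h3 : 1 ≤ (1 + δ / (1 / 2 - δ)) ^ M := one_le_pow₀ (by
    have : 0 ≤ δ / (1 / 2 - δ) := div_nonneg hδ0 (by linarith)
    linarith)
  calc (5 : ℝ) = 5 * 1 * 1 * 1 := by ring
    _ ≤ 5 * (2 / η) ^ S.card * 3 ^ R.card * (1 + δ / (1 / 2 - δ)) ^ M := by
        gcongr

/-- **`‖E(s)‖ ≤ Emaj η`** for `Re s > 1/2`, `‖s − 1‖ ≥ 1/4`, `‖s − ω‖ ≥ η` (`ω ∈ S`), `0 < η ≤ 1`, `δ < 1/2`.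
[cite: BrouckeDebruyneRevesz2023, proof of Theorem 3.2 (the bound for `|ζ_𝒫(σ_x + it)|`)] -/
theorem norm_E_le (h : Adm R S δ M) (hδ2 : δ < 1 / 2) {η : ℝ} (hη0 : 0 < η) (hη1 : η ≤ 1) {s : ℂ}
    (hs : 1 / 2 < s.re) (h1 : 1 / 4 ≤ ‖s - 1‖) (hω : ∀ ω ∈ S, η ≤ ‖s - ω‖) :
    ‖E R S δ M s‖ ≤ Emaj R S δ M η := by
  have hδ0 := h.hδ0
  unfold E Emaj
  rw [norm_mul, norm_mul, norm_mul, norm_pow, Complex.norm_prod, Complex.norm_prod]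
  have hA : ‖s / (s - 1)‖ ≤ 5 := BV.norm_div_sub_one_le h1
  have hB : ∏ ω ∈ S, ‖s / (s - ω)‖ ≤ (2 / η) ^ S.card := by
    rw [← Finset.prod_const]
    refine Finset.prod_le_prod (fun _ _ ↦ norm_nonneg _) fun ω hωS ↦ ?_
    have hω1 : ω ≤ 1 := (h.hS ω hωS).2.le
    calc ‖s / (s - ω)‖ ≤ 1 + ω / η := norm_div_sub_le (h.hS ω hωS).1.le hη0 (hω ω hωS)
      _ ≤ 1 / η + 1 / η := by
          refine add_le_add ?_ (div_le_div_of_nonneg_right hω1 hη0.le)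
          rw [le_div_iff₀ hη0]; linarith
      _ = 2 / η := by ring
  have hC : ∏ ρ ∈ R, ‖(s - ρ) / s‖ ≤ (3 : ℝ) ^ R.card := by
    rw [← Finset.prod_const]
    exact Finset.prod_le_prod (fun _ _ ↦ norm_nonneg _) fun ρ hρ ↦
      norm_sub_div_le (h.hR ρ hρ).1.le (h.hR ρ hρ).2.le hs
  have hD : ‖s / (s - δ)‖ ≤ 1 + δ / (1 / 2 - δ) := by
    refine norm_div_sub_le hδ0.le (by linarith) ?_
    have : ((s - (δ : ℂ)).re) ≤ ‖s - (δ : ℂ)‖ := (le_abs_self _).trans (Complex.abs_re_le_norm _)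
    simp at this
    linarith
  have hD' : ‖s / (s - δ)‖ ^ M ≤ (1 + δ / (1 / 2 - δ)) ^ M := pow_le_pow_left₀ (norm_nonneg _) hD M
  have h5 : (0 : ℝ) ≤ 5 := by norm_num
  have hBn : 0 ≤ ∏ ω ∈ S, ‖s / (s - ω)‖ := Finset.prod_nonneg fun _ _ ↦ norm_nonneg _
  have hCn : 0 ≤ ∏ ρ ∈ R, ‖(s - ρ) / s‖ := Finset.prod_nonneg fun _ _ ↦ norm_nonneg _
  have hDn : 0 ≤ ‖s / (s - δ)‖ ^ M := pow_nonneg (norm_nonneg _) M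
  calc ‖s / (s - 1)‖ * (∏ ω ∈ S, ‖s / (s - ω)‖) * (∏ ρ ∈ R, ‖(s - ρ) / s‖) * ‖s / (s - δ)‖ ^ M
      ≤ 5 * (2 / η) ^ S.card * (3 : ℝ) ^ R.card * (1 + δ / (1 / 2 - δ)) ^ M := by
        gcongr

/-- **The majorant of `G` on the strip**: for `1/2 + η ≤ Re s ≤ 3/2` (`0 < η ≤ 1`), `‖s − 1‖ ≥ 1/4`, `‖s − ω‖ ≥ η`
(`ω ∈ S`): `‖G(s)‖ ≤ (Emaj η/5) · B_η(|Im s|)` with the tree's `B_η(t) = 8 e^{C/η} e^{(C/√η)√log(t+1)}` and `C` the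
constant of (3.4) on `σ ≤ 2` (`BDRZeta.norm_Z_le_of_le_two`).
[cite: BrouckeDebruyneRevesz2023, proof of Theorem 3.2 (the bound for `|ζ_𝒫(σ_x + it)|`)] -/
theorem norm_contZeta_le (h : Adm R S δ M) (hδ2 : δ < 1 / 2) {A A' : ℝ} (hA : BV.Approx (f R S δ M) P A)
    (hπ : ∀ y : ℝ, 1 ≤ y → |(P.primeCount y : ℝ) - F R S δ M y| ≤ A') {η : ℝ} (hη0 : 0 < η) (hη1 : η ≤ 1)
    {s : ℂ} (hs : 1 / 2 + η ≤ s.re) (hs2 : s.re ≤ 3 / 2) (h1 : 1 / 4 ≤ ‖s - 1‖) (hω : ∀ ω ∈ S, η ≤ ‖s - ω‖) :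
    ‖contZeta R S δ M P s‖ ≤ Emaj R S δ M η / 5 * BV.Bmaj (BV.CZ P (apxT R S M A) (cmpK R S M)) η |s.im| := by
  set C := BV.CZ P (apxT R S M A) (cmpK R S M) with hCdef
  have hAT := h.approx_fT hA
  have hC : 0 ≤ C := by
    have := hAT.nonneg; have := BV.cmpConst_nonneg h.g_sub_fT_mem; have := BV.E₁const_nonneg P
    rw [hCdef]; unfold BV.CZ apxT; positivity
  have hσ : 1 / 2 < s.re := by linarith
  have hZ := h.norm_Z_le_of_le_two P hA hπ hσ (by linarith)
  set ℓ := Real.log (|s.im| + 1) with hℓdef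
  have h1' : 1 / (s.re - 1 / 2) ≤ 1 / η := one_div_le_one_div_of_le hη0 (by linarith)
  have h2' : Real.sqrt ℓ / Real.sqrt (s.re - 1 / 2) ≤ Real.sqrt ℓ / Real.sqrt η :=
    div_le_div_of_nonneg_left (Real.sqrt_nonneg _) (Real.sqrt_pos.mpr hη0) (Real.sqrt_le_sqrt (by linarith))
  have hZ' : ‖Z R S δ M P s‖ ≤ C / η + C / Real.sqrt η * Real.sqrt ℓ := by
    calc ‖Z R S δ M P s‖ ≤ C * (1 / (s.re - 1 / 2) + Real.sqrt ℓ / Real.sqrt (s.re - 1 / 2)) := hZ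
      _ ≤ C * (1 / η + Real.sqrt ℓ / Real.sqrt η) := mul_le_mul_of_nonneg_left (add_le_add h1' h2') hC
      _ = C / η + C / Real.sqrt η * Real.sqrt ℓ := by ring
  have hexp : ‖Complex.exp (Z R S δ M P s)‖ ≤ Real.exp (C / η) * Real.exp (C / Real.sqrt η * Real.sqrt ℓ) := by
    rw [Complex.norm_exp, ← Real.exp_add]
    exact Real.exp_le_exp.mpr ((Complex.re_le_norm _).trans hZ')
  have hE := norm_E_le h hδ2 hη0 hη1 hσ h1 hω
  have hE0 : 0 ≤ Emaj R S δ M η := le_trans (by norm_num) (five_le_Emaj h.hδ0.le hδ2 hη0 hη1)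
  rw [BV.Bmaj_abs, contZeta, norm_mul]
  calc ‖E R S δ M s‖ * ‖Complex.exp (Z R S δ M P s)‖
      ≤ Emaj R S δ M η * (Real.exp (C / η) * Real.exp (C / Real.sqrt η * Real.sqrt ℓ)) :=
        mul_le_mul hE hexp (norm_nonneg _) hE0
    _ ≤ Emaj R S δ M η / 5 * (8 * Real.exp (C / η) * Real.exp (C / Real.sqrt η * Real.sqrt ℓ)) := by
        have : 0 ≤ Real.exp (C / η) * Real.exp (C / Real.sqrt η * Real.sqrt ℓ) := by positivity
        nlinarith

/-- `G` is differentiable at every `s` with `Re s > 1/2` off `T` (`E` is rational with non-vanishing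
denominators there, `Z` is holomorphic). [cite: BrouckeDebruyneRevesz2023, proof of Theorem 3.2] -/
theorem differentiableAt_contZeta (h : Adm R S δ M) (hδ2 : δ < 1 / 2) {A' : ℝ}
    (hπ : ∀ y : ℝ, 1 ≤ y → |(P.primeCount y : ℝ) - F R S δ M y| ≤ A') {s : ℂ} (hs : 1 / 2 < s.re)
    (hsT : ∀ p ∈ poles S, s ≠ (p : ℂ)) : DifferentiableAt ℂ (contZeta R S δ M P) s := by
  have hs0 : s ≠ 0 := fun h0 ↦ by rw [h0] at hs; simp at hs; linarith
  have hs1 : s - 1 ≠ 0 := sub_ne_zero.mpr (hsT 1 (mem_poles.mpr (Or.inl rfl)))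
  have hsub : ∀ ω ∈ S, s - (ω : ℂ) ≠ 0 := by
    intro ω hω h0
    rcases lt_or_ge (1 / 2 : ℝ) ω with hω2 | hω2
    · exact hsT ω (mem_poles.mpr (Or.inr ⟨hω, hω2⟩)) (sub_eq_zero.mp h0)
    · have := congrArg Complex.re h0; simp at this; linarith
  have hsδ : s - (δ : ℂ) ≠ 0 := fun h0 ↦ by have := congrArg Complex.re h0; simp at this; linarith
  have hZ : DifferentiableAt ℂ (Z R S δ M P) s :=
    (h.differentiableOn_Z P hπ).differentiableAt
      ((isOpen_lt continuous_const Complex.continuous_re).mem_nhds (by simp; linarith))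
  have hid : DifferentiableAt ℂ (fun s : ℂ ↦ s) s := differentiableAt_id
  unfold contZeta E
  refine DifferentiableAt.mul ?_ hZ.cexp
  refine ((DifferentiableAt.mul ?_ ?_).mul ?_).mul ?_
  · exact hid.div (hid.sub (differentiableAt_const _)) hs1
  · exact DifferentiableAt.fun_finsetProd fun ω hω ↦ hid.div (hid.sub (differentiableAt_const _)) (hsub ω hω)
  · exact DifferentiableAt.fun_finsetProd fun ρ _ ↦ (hid.sub (differentiableAt_const _)).div hid hs0
  · exact (hid.div (hid.sub (differentiableAt_const _)) hsδ).pow M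

end BDR

end Literature.NumberTheory.BeurlingPrimes
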